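import Summits.ABC.IUTFork.Joshi.ATS4RamificationTateDivisor
import Literature.IUT.LogVolume.Corollary22QParamBaseChange
import HarnessLib

/-!
# [J-IV] Definition 4.4.2 / Proposition 4.4.4 INSTANTIATED on the tree's Legendre `λ`-line: Joshi's Tate divisor is
# the cell's `q`-parameter divisor, and Proposition 4.4.4 holds there UNCONDITIONALLY

Record file of the abc-iut cell, branch E «type Joshi's construction, test vs S» (rung LADDER-ABC:A2.E; seat abc-iut-E-t26,
slot T-26 fallback (1) «DERIVABLE rows of a landed Joshi file»). TAKES NO SIDE on [IUTchIII] Cor. 3.12, on Joshi's claims, or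
on Mochizuki's reports on them; typed ≠ proved ≠ endorsed. Source: K. Joshi, *Construction of Arithmetic Teichmuller Spaces
IV*, arXiv:2403.10430v2 (UNREFEREED, bib `Joshi2024ATS4`), §4.4, render `HOME/lit/renders/Joshi-arxiv-2403.10430/` p.40
l.23–p.42 l.70; and the cell's kernel-checked [IUTchIV] Cor. 2.2 / Thm. 1.10 files (`Literature.IUT.LogVolume.Corollary22*`).

## Content (a DICTIONARY row made kernel-checkable; PROOF-ONLY apart from the one instantiating `def`)

The companion `Joshi/ATS4RamificationTateDivisor.lean` types Joshi's Tate divisor `𝔮_M = Σ_{w ∈ V^{odd,ss}_M} ord_w(q_w)·w`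
(Def. 4.4.2) over an abstract signature `TateDivisorDatum M` and PROVES Prop. 4.4.4 `log(𝔮_M) = log(𝔮_{L_mod})` from the typed
claim-`Prop` `IsBaseChangeOf` (the Tate-curve step of the printed proof, p.41 l.32–42: «`q_w = q_v` is also the Tate parameter
over `𝒪_{M_w}` … `ord_w(q_w) = e_{w|v}·ord_v(q_v)`», together with «`V^{odd,ss}_M` = inverse image of `V_{L_mod}`», p.40
l.35–40). Here that signature is INSTANTIATED on the one family of elliptic curves over number fields the tree carries — the
Legendre curves `y² = x(x−1)(x−λ)` of the `λ`-line `U_X`, `X = ℙ¹ ∖ {0,1,∞}` ([IUTchIV] Cor. 2.2; the tree's `NFPoint` = a point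
`λ` presented over a number field `F`): `V ↦` the bad places of `λ/F` (poles of `j(λ)`, tree `Cor22.badPlaces`) avoiding a
finite set `S` of rational primes (`S ∋ 2` realises «odd residue characteristic»), `ord_w(q_w) ↦` the local height
`max(0, −ord_w j(λ))` ([GenEll] Def. 3.3 / Rmk. 3.3.1 = Joshi's Remark 4.4.3; tree `Cor22.localHeight`). PROVED:

* `tateDivisor_ofNFPoint` — Joshi's `𝔮_F` IS the cell's `q`-parameter divisor `Cor22.qDivisor P S` («the effective arithmetic
  divisor determined by the `q`-parameters», [IUTchIV] Cor. 2.2 (i) p.41) viewed as an `ℝ`-arithmetic divisor, and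
  `logq_ofNFPoint` — Joshi's `log(𝔮_F)` IS the cell's `Cor22.logQAvoid P S`;
* `isBaseChangeOf_ofNFPoint` — for `λ` presented over `F_tpd` (`P`) and over a finite extension `F ⊇ F_tpd` (`Q`,
  `Q.x = λ`), Joshi's base-change relation HOLDS (bad places correspond under `w ↦ w|_{F_tpd}`, `h_w = e_{w|v}·h_v`: tree
  `Cor22.mem_badPlaces_iff_of_algebraMap`, `Cor22.localHeight_of_algebraMap`) — i.e. the claim-`Prop` of the companion file is
  DISCHARGED on this model;
* `prop444_ofNFPoint` — hence **Proposition 4.4.4 holds unconditionally on the `λ`-line**, by Joshi's own route (pull-back +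
  [IUTchIV] Def. 1.9 (i)); `prop444_ofNFPoint_iff_tree` records that this is the SAME equality as the cell's
  `Cor22.logQAvoid_of_algebraMap` ([IUTchIV] Thm. 1.10 p.23 «the various `log(q_{(−)})`'s are independent of the choice of
  `F□`» — the property Joshi (p.41 l.17–18) says is «asserted without proof in [Mochizuki, 2021d]»; in the tree it is a theorem).

Modelling note (for the faithfulness referee): at a place of POTENTIALLY multiplicative reduction the local height
`max(0, −ord_v j)` is the order of the Tate parameter of the Tate curve with that `j`-invariant whether or not the reduction is
already split multiplicative over `F` ([GenEll] Rmk. 3.3.1); Joshi's `V^{odd,ss}` over the fields `L ⊇ L_tpd` of §4.1.2, where all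
bad reduction is semi-stable (Prop. 4.1.1), is the case `S = {2}` (resp. `{2, ℓ}`) of this instantiation. Nothing here binds the
cell's frozen `Cor312*` / `Thm311*` interface (R14); no judgement.
-/

noncomputable section

open NumberField IsDedekindDomain Finset
open Literature.IUT.LogVolume Literature.IUT.LogVolume.Cor22
open Literature.NumberTheory.DiophantineGeometry.GenEll

namespace Summit.ABC.IUTFork.Joshi.ATS4

namespace TateDivisorDatum

open scoped Classical in
/-- **Joshi's Tate divisor datum of the Legendre curve `y² = x(x−1)(x−λ)` over `F`, away from `S`** ([J-IV] Def. 4.4.2 on the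
`λ`-line of [IUTchIV] Cor. 2.2): `V :=` the bad places of `λ/F` not over a prime of `S`, `ord_w(q_w) :=` the local height
`max(0, −ord_w j(λ))` (Joshi's Remark 4.4.3 = [GenEll] Def. 3.3), positive on `V` (a pole of `j`).
[claim: Joshi2024ATS4, status: disputed] -/
def ofNFPoint (P : NFPoint) (S : Finset ℕ) : TateDivisorDatum P.F where
  V := (badPlaces P).filter (fun v => ∀ p ∈ S, ((p : ℕ) : 𝓞 P.F) ∉ v.asIdeal)
  ordq v := (-(ord P.F v (jInv P.x))).toNat
  ordq_pos := by
    intro w hw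
    rw [Finset.mem_filter, mem_badPlaces_iff_ord_neg] at hw
    exact Int.lt_toNat.mpr (by simpa using hw.1)

section OnePoint

variable (P : NFPoint) (S : Finset ℕ)

open scoped Classical in
/-- Membership in `V`: a bad place avoiding `S`. [folklore] -/
theorem mem_ofNFPoint_V (v : HeightOneSpectrum (𝓞 P.F)) :
    v ∈ (ofNFPoint P S).V ↔ v ∈ badPlaces P ∧ ∀ p ∈ S, ((p : ℕ) : 𝓞 P.F) ∉ v.asIdeal :=
  Finset.mem_filter

/-- Joshi's `ord_w(q_w)` on this model IS the cell's local height `h_w(λ)` (as a real number). [folklore] -/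
theorem ordq_ofNFPoint_cast (v : HeightOneSpectrum (𝓞 P.F)) : ((ofNFPoint P S).ordq v : ℝ) = localHeight P v := rfl

/-- **Joshi's Tate divisor `𝔮_F` of the Legendre curve IS the cell's `q`-parameter divisor** `Cor22.qDivisor P S` ([IUTchIV]
Cor. 2.2 (i): «the effective arithmetic divisor determined by the `q`-parameters»), as `ℝ`-arithmetic divisors.
[cite: Mochizuki2012, IUTchIV Cor 2.2 (i) p.41] -/
theorem tateDivisor_ofNFPoint : (ofNFPoint P S).tateDivisor = ADivisor.ofFinDivisor P.F (qDivisor P S) := by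
  classical
  ext (w | w)
  · rw [tateDivisor_apply_inl, ADivisor.ofFinDivisor_apply_inl]
  · rw [tateDivisor_apply_inr, ADivisor.ofFinDivisor_apply_inr, qDivisor_apply, ordq_ofNFPoint_cast]
    simp only [mem_ofNFPoint_V]

/-- **Joshi's `log(𝔮_F)` IS the cell's `log(q^{∤S}(λ))`** (`Cor22.logQAvoid`). [cite: Mochizuki2012, IUTchIV Cor 2.2 (i) p.41] -/
theorem logq_ofNFPoint : (ofNFPoint P S).logq = logQAvoid P S := by
  rw [logq, tateDivisor_ofNFPoint, ndeg_ofFinDivisor, logQAvoid]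

/-- Joshi's `log(𝔣_F)` (reduced Tate divisor) on this model: `(1/[F:ℚ])·Σ_{v bad, v ∤ S} log v`. [folklore] -/
theorem logf_ofNFPoint : (ofNFPoint P S).logf = (∑ v ∈ (ofNFPoint P S).V, logNorm P.F v) / Module.finrank ℚ P.F :=
  (ofNFPoint P S).logf_eq_sum

end OnePoint

section BaseChange

variable {P Q : NFPoint} [Algebra P.F Q.F] (hx : Q.x = algebraMap P.F Q.F P.x)
include hx

/-- **Joshi's base-change relation HOLDS on the `λ`-line**: for `λ` presented over `F_tpd` (`P`) and over `F ⊇ F_tpd` (`Q`,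
same coordinate), the datum over `F` is the base change of the datum over `F_tpd` — bad places correspond under `w ↦ w|_{F_tpd}`
with the same divisibility conditions, and `h_w = e_{w|v}·h_v` (the printed step «`ord_w(q_w) = e_{w|v}·ord_v(q_v)`», p.41
l.39–42). This DISCHARGES the claim-`Prop` `IsBaseChangeOf` for this model. [cite: Mochizuki2012, IUTchIV Cor 2.2 proof (P2) p.45] -/
theorem isBaseChangeOf_ofNFPoint (S : Finset ℕ) : (ofNFPoint Q S).IsBaseChangeOf (ofNFPoint P S) := by
  refine ⟨fun w => ?_, fun w _ => ?_⟩
  · rw [mem_ofNFPoint_V, mem_ofNFPoint_V, mem_badPlaces_iff_of_algebraMap hx w]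
    refine and_congr Iff.rfl (forall₂_congr fun p _ => not_congr ?_)
    exact (natCast_mem_finBelow_iff (P := P) w p).symm
  · have h : ((ofNFPoint Q S).ordq w : ℝ) =
        ((relRamIdx P.F Q.F w * (ofNFPoint P S).ordq (finBelow P.F Q.F w) : ℕ) : ℝ) := by
      rw [Nat.cast_mul, ordq_ofNFPoint_cast, ordq_ofNFPoint_cast, localHeight_of_algebraMap hx w]
      rfl
    exact_mod_cast h

/-- **[J-IV] Proposition 4.4.4, UNCONDITIONAL on the `λ`-line**: `log(𝔮_F) = log(𝔮_{F_tpd})` for the Legendre curve of `λ`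
presented over `F ⊇ F_tpd`, by Joshi's route (`𝔮_F = 𝔮_{F_tpd}|_F` and [IUTchIV] Def. 1.9 (i), companion `prop444`).
[cite: Mochizuki2012, IUTchIV Thm 1.10 p.23] -/
theorem prop444_ofNFPoint (S : Finset ℕ) : (ofNFPoint Q S).logq = (ofNFPoint P S).logq :=
  (ofNFPoint Q S).prop444 (ofNFPoint P S) (isBaseChangeOf_ofNFPoint hx S)

end BaseChange

/-- Concordance: Joshi's Prop. 4.4.4 on the `λ`-line and the tree's independence statement `Cor22.logQAvoid_of_algebraMap`
([IUTchIV] Thm. 1.10 p.23 «the various `log(q_{(−)})`'s are independent of the choice of `F□`») are the SAME proposition (so the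
latter is not restated here). [folklore] -/
theorem prop444_ofNFPoint_iff_tree (P Q : NFPoint) (S : Finset ℕ) :
    (ofNFPoint Q S).logq = (ofNFPoint P S).logq ↔ logQAvoid Q S = logQAvoid P S := by
  rw [logq_ofNFPoint, logq_ofNFPoint]

/-- The case `Q = Cor22.extend P F` («`x ∈ U_X(F_tpd) ⊆ U_X(F)`», [IUTchIV] p.42): Prop. 4.4.4 for the point regarded over
any finite extension. [cite: Mochizuki2012, IUTchIV Thm 1.10 p.23] -/
theorem prop444_extend (P : NFPoint) (F : Type) [Field F] [NumberField F] [Algebra P.F F] (S : Finset ℕ) :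
    (ofNFPoint (Cor22.extend P F) S).logq = (ofNFPoint P S).logq :=
  letI : Algebra P.F (Cor22.extend P F).F := ‹Algebra P.F F›
  prop444_ofNFPoint (P := P) (Q := Cor22.extend P F) rfl S

end TateDivisorDatum

end Summit.ABC.IUTFork.Joshi.ATS4
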